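import Literature.NumberTheory.Transcendental.CalegariDimitrovTangL2Chi3ModSix
import Literature.NumberTheory.Transcendental.BlochWignerDilogarithm
import HarnessLib

/-!
# `Im Li₂(e^{iθ}) = Σ sin(nθ)/n²` (Clausen) for the tree's `dilog`, and CDT's remark
`3√3 L(2,χ₋₃)/4 = Im Li₂(e^{πi/3})` (the volume of the regular ideal tetrahedron)

Sibling of `CalegariDimitrovTangL2Chi3.lean` (named fact
`Literature.NumberTheory.Transcendental.calegariDimitrovTang_linearIndependent`, CDT 2024
Thm. 1; glue constant `L2chi3`) and of `BlochWignerDilogarithm.lean` (the tree's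
`dilog z = −∫₀¹ log(1 − zs) ds/s`, `blochWignerDilog z = Im Li₂(z) + arg(1−z) log|z|`).
CDT, §1.1 (p. 3): "The constant `3√3 L(2,χ₋₃)/4 = Im(Li₂(e^{πi/3})) = (3/2)·Im(Li₂(e^{2πi/3}))
= 1.014941…` is the volume of the regular ideal hyperbolic tetrahedron (the one of the maximal
volume), and is also the volume of the non-compact hyperbolic manifold with minimal volume (the
Gieseking manifold …). … [our result] is the first unconditional result to make contact with the
arithmetic nature of these volumes."

This file PROVES that identity for the tree's objects, through **Clausen's formula** for the
integral `dilog` on the unit circle: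

* `hasSum_dilog_exp_mul_I` — `Li₂(e^{iθ}) = Σ_{n≥0} e^{i(n+1)θ}/(n+1)²` for every real `θ`
  (term-wise integration of `−log(1 − e^{iθ}s)/s = Σ e^{i(n+1)θ}sⁿ/(n+1)` on `(0,1)`, dominated
  convergence with the summable bounds `sⁿ/(n+1)` whose sum `−log(1−s)/s` is integrable);
* `hasSum_sin_div_sq_im_dilog` — **`Im Li₂(e^{iθ}) = Σ_{n≥1} sin(nθ)/n²`** (`= Cl₂(θ)`);
* `im_dilog_exp_pi_div_three_mul_I` — **`Im Li₂(e^{πi/3}) = 3√3 L(2,χ₋₃)/4`**, by summing the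
  Clausen series along `n mod 6` (`sin(nπ/3) = √3/2, √3/2, 0, −√3/2, −√3/2, 0`) against the
  mod-`3`/mod-`6` decompositions of `ζ(2)` in `…L2Chi3.lean` / `…ModSix.lean`;
* `blochWignerDilog_exp_pi_div_three_mul_I` — `D(e^{πi/3}) = 3√3 L(2,χ₋₃)/4` (`log|e^{πi/3}| = 0`);
* `im_dilog_exp_two_pi_div_three_mul_I`, `im_dilog_exp_pi_div_three_mul_I_eq_three_halves_mul` —
  the middle expression: `Im Li₂(e^{2πi/3}) = (√3/2) L(2,χ₋₃)` (along `n mod 3`), hence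
  `Im Li₂(e^{πi/3}) = (3/2)·Im Li₂(e^{2πi/3})`.

No named facts (D-0026); everything is unconditional. Not here: the identification of `D` with
tetrahedron volumes (a route item of `BlochWignerDilogarithm.lean`), and `Cl₂` as a function.

## References

* [CalegariDimitrovTang2024] F. Calegari, V. Dimitrov, Y. Tang, arXiv:2408.15403, §1.1 (p. 3).
* J. Milnor, *Hyperbolic geometry: the first 150 years*, Bull. AMS 6 (1982), Appendix, eq. (2)
  (`2Л(θ) = Σ sin(2nθ)/n²`) — the classical Clausen/Lobachevsky series, cited for context through
  `BlochWignerDilogarithm.lean`.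
-/

noncomputable section

open MeasureTheory Set Filter Real intervalIntegral Complex
open scoped Topology

namespace Literature.NumberTheory.Transcendental

/-! ### The series of the integrand `−log(1 − e^{iθ}s)/s` on `(0,1)` -/

/-- For `0 < s < 1`, `−log(1 − ωs)/s = Σ_{n ≥ 0} ω^{n+1} sⁿ/(n+1)` with `ω = e^{iθ}` (the
logarithmic series, `‖ωs‖ = s < 1`). [folklore] -/
theorem hasSum_dilogIntegrand {θ s : ℝ} (hs0 : 0 < s) (hs1 : s < 1) :
    HasSum (fun n : ℕ => cexp (θ * I) ^ (n + 1) * (s : ℂ) ^ n / (n + 1))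
      (-Complex.log (1 - cexp (θ * I) * s) / s) := by
  set ω := cexp (θ * I) with hω_def
  have hω : ‖ω‖ = 1 := Complex.norm_exp_ofReal_mul_I θ
  have hnorm : ‖ω * s‖ < 1 := by
    rw [norm_mul, hω, one_mul, Complex.norm_real, Real.norm_eq_abs, abs_of_pos hs0]
    exact hs1
  have h := Complex.hasSum_taylorSeries_neg_log hnorm
  have h1 := (hasSum_nat_add_iff' 1).mpr h
  rw [Finset.sum_range_one, pow_zero, Nat.cast_zero, div_zero, sub_zero] at h1
  have h2 := h1.div_const (s : ℂ)
  have hs : (s : ℂ) ≠ 0 := Complex.ofReal_ne_zero.mpr hs0.ne'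
  refine h2.congr_fun fun n => ?_
  rw [mul_pow, pow_succ (s : ℂ) n]
  push_cast
  field_simp

/-- The norm of the `n`-th term: `‖ω^{n+1} sⁿ/(n+1)‖ = sⁿ/(n+1)` for `s ≥ 0`. [folklore] -/
theorem norm_dilogTerm (θ : ℝ) {s : ℝ} (hs : 0 ≤ s) (n : ℕ) :
    ‖cexp (θ * I) ^ (n + 1) * (s : ℂ) ^ n / (n + 1)‖ = s ^ n / (n + 1) := by
  have hω : ‖cexp (θ * I)‖ = 1 := Complex.norm_exp_ofReal_mul_I θ
  have hn : ((n : ℂ) + 1) = ((n + 1 : ℕ) : ℂ) := by push_cast; ring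
  rw [norm_div, norm_mul, norm_pow, norm_pow, hω, one_pow, one_mul, Complex.norm_real,
    Real.norm_eq_abs, abs_of_nonneg hs, hn, Complex.norm_natCast]
  push_cast
  ring

/-- For `0 ≤ t < 1` the bounds `tⁿ/(n+1)` are summable (comparison with the geometric series).
[folklore] -/
theorem summable_pow_div_succ {t : ℝ} (h0 : 0 ≤ t) (h1 : t < 1) :
    Summable fun n : ℕ => t ^ n / ((n : ℝ) + 1) := by
  refine (summable_geometric_of_lt_one h0 h1).of_nonneg_of_le (fun n => by positivity) fun n => ?_
  exact div_le_self (pow_nonneg h0 n) (by linarith [(n.cast_nonneg : (0 : ℝ) ≤ n)])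

/-- For `0 < t < 1`, `Σ_{n≥0} tⁿ/(n+1) = −log(1−t)/t`. [folklore] -/
theorem tsum_pow_div_succ {t : ℝ} (h0 : 0 < t) (h1 : t < 1) :
    ∑' n : ℕ, t ^ n / ((n : ℝ) + 1) = -Real.log (1 - t) / t := by
  have h := Real.hasSum_pow_div_log_of_abs_lt_one (x := t) (by rw [abs_of_pos h0]; exact h1)
  have h2 := h.div_const t
  have h3 : HasSum (fun n : ℕ => t ^ n / ((n : ℝ) + 1)) (-Real.log (1 - t) / t) := by
    refine h2.congr_fun fun n => ?_
    rw [pow_succ]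
    field_simp
  exact h3.tsum_eq

/-- `−log(1−t)/t` is integrable on `[0,1]`: it is bounded by `2 + 2|log(1−t)|`
(`−log(1−t) ≤ t/(1−t)` for `t < 1/2`, `1/t ≤ 2` for `t ≥ 1/2`). [folklore] -/
theorem intervalIntegrable_neg_log_one_sub_div :
    IntervalIntegrable (fun t : ℝ => -Real.log (1 - t) / t) volume 0 1 := by
  have hlog : IntervalIntegrable (fun t : ℝ => Real.log (1 - t)) volume 0 1 := by
    simpa using (intervalIntegrable_log' (a := (1 : ℝ)) (b := 0)).comp_sub_left 1
  have hG : IntervalIntegrable (fun t : ℝ => 2 + 2 * ‖Real.log (1 - t)‖) volume 0 1 :=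
    intervalIntegrable_const.add (hlog.norm.const_mul 2)
  refine hG.mono_fun' ?_ ?_
  · exact (by fun_prop : Measurable fun t : ℝ => -Real.log (1 - t) / t).aestronglyMeasurable
  · rw [Filter.EventuallyLE, ae_restrict_iff' measurableSet_uIoc]
    refine ae_of_all _ fun t ht => ?_
    rw [uIoc_of_le zero_le_one] at ht
    obtain ⟨ht0, ht1⟩ := ht
    have hlogle : Real.log (1 - t) ≤ 0 := Real.log_nonpos (by linarith) (by linarith)
    rw [Real.norm_eq_abs, Real.norm_eq_abs, abs_div, abs_neg, abs_of_pos ht0,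
      abs_of_nonpos hlogle]
    rcases lt_or_ge t (1 / 2) with hhalf | hhalf
    · -- `t < 1/2`: `−log(1−t) ≤ t/(1−t) ≤ 2t`
      have h1t : 0 < 1 - t := by linarith
      have hle : -Real.log (1 - t) ≤ t / (1 - t) := by
        have h := Real.log_le_sub_one_of_pos (inv_pos.mpr h1t)
        rw [Real.log_inv] at h
        have e : (1 - t)⁻¹ - 1 = t / (1 - t) := by field_simp; ring
        rwa [e] at h
      have hle2 : -Real.log (1 - t) / t ≤ 2 := by
        rw [div_le_iff₀ ht0]
        calc -Real.log (1 - t) ≤ t / (1 - t) := hle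
          _ ≤ 2 * t := by rw [div_le_iff₀ h1t]; nlinarith
      linarith [abs_nonneg (Real.log (1 - t)), neg_nonneg.mpr hlogle]
    · -- `t ≥ 1/2`: `1/t ≤ 2`
      have hle : -Real.log (1 - t) / t ≤ 2 * -Real.log (1 - t) := by
        rw [div_le_iff₀ ht0]
        nlinarith [neg_nonneg.mpr hlogle]
      linarith [neg_nonneg.mpr hlogle]

/-- **Term-wise integration is legitimate** (dominated convergence with the summable bounds
`tⁿ/(n+1)`, whose sum `−log(1−t)/t` is integrable): the integrals `∫₀¹ ω^{n+1}sⁿ/(n+1) ds` sum to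
`∫₀¹ −log(1−ωs)/s ds`. [folklore] -/
theorem hasSum_integral_dilogTerm (θ : ℝ) :
    HasSum (fun n : ℕ => ∫ s in (0 : ℝ)..1, cexp (θ * I) ^ (n + 1) * (s : ℂ) ^ n / (n + 1))
      (∫ s in (0 : ℝ)..1, -Complex.log (1 - cexp (θ * I) * s) / s) := by
  refine intervalIntegral.hasSum_integral_of_dominated_convergence
    (fun n s => s ^ n / ((n : ℝ) + 1)) (fun n => ?_) (fun n => ?_) ?_ ?_ ?_
  · exact (Continuous.aestronglyMeasurable (by fun_prop))
  · refine ae_of_all _ fun t ht => ?_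
    rw [uIoc_of_le zero_le_one] at ht
    rw [norm_dilogTerm θ ht.1.le n]
  · filter_upwards [Measure.ae_ne volume (1 : ℝ)] with t ht1 ht
    rw [uIoc_of_le zero_le_one] at ht
    exact summable_pow_div_succ ht.1.le (lt_of_le_of_ne ht.2 ht1)
  · -- the sum of the bounds is `−log(1−t)/t` a.e. on `(0,1]`
    have hg := intervalIntegrable_neg_log_one_sub_div
    rw [intervalIntegrable_iff] at hg ⊢
    refine hg.congr ?_
    rw [Filter.EventuallyEq, ae_restrict_iff' measurableSet_uIoc]
    filter_upwards [Measure.ae_ne volume (1 : ℝ)] with t ht1 ht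
    rw [uIoc_of_le zero_le_one] at ht
    exact (tsum_pow_div_succ ht.1 (lt_of_le_of_ne ht.2 ht1)).symm
  · filter_upwards [Measure.ae_ne volume (1 : ℝ)] with t ht1 ht
    rw [uIoc_of_le zero_le_one] at ht
    exact hasSum_dilogIntegrand ht.1 (lt_of_le_of_ne ht.2 ht1)

/-- `∫₀¹ ω^{n+1} sⁿ/(n+1) ds = ω^{n+1}/(n+1)²`. [folklore] -/
theorem integral_dilogTerm (θ : ℝ) (n : ℕ) :
    ∫ s in (0 : ℝ)..1, cexp (θ * I) ^ (n + 1) * (s : ℂ) ^ n / (n + 1)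
      = cexp (θ * I) ^ (n + 1) / ((n : ℂ) + 1) ^ 2 := by
  have e : (fun s : ℝ => cexp (θ * I) ^ (n + 1) * (s : ℂ) ^ n / (n + 1))
      = fun s : ℝ => cexp (θ * I) ^ (n + 1) / (n + 1) * (((s ^ n : ℝ)) : ℂ) := by
    funext s
    push_cast
    ring
  rw [e, intervalIntegral.integral_const_mul, intervalIntegral.integral_ofReal, integral_pow]
  have hn : ((n : ℂ) + 1) ≠ 0 := by exact_mod_cast Nat.succ_ne_zero n
  push_cast
  field_simp
  ring

/-- **The dilogarithm series on the unit circle**: `Li₂(e^{iθ}) = Σ_{n≥0} e^{i(n+1)θ}/(n+1)²`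
for the tree's integral definition `dilog z = −∫₀¹ log(1−zs) ds/s`. [folklore] -/
theorem hasSum_dilog_exp_mul_I (θ : ℝ) :
    HasSum (fun n : ℕ => cexp (θ * I) ^ (n + 1) / ((n : ℂ) + 1) ^ 2) (dilog (cexp (θ * I))) := by
  have h := hasSum_integral_dilogTerm θ
  simp only [integral_dilogTerm] at h
  have e : dilog (cexp (θ * I)) = ∫ s in (0 : ℝ)..1, -Complex.log (1 - cexp (θ * I) * s) / s := by
    rw [dilog_def, ← intervalIntegral.integral_neg]
    refine intervalIntegral.integral_congr fun s _ => ?_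
    simp only [neg_div]
  rw [e]
  exact h

/-- **Clausen's formula for the tree's `dilog`**: `Im Li₂(e^{iθ}) = Σ_{n≥1} sin(nθ)/n²`
(`= Cl₂(θ)`), for every real `θ`. [folklore] -/
theorem hasSum_sin_div_sq_im_dilog (θ : ℝ) :
    HasSum (fun n : ℕ => Real.sin (((n : ℝ) + 1) * θ) / ((n : ℝ) + 1) ^ 2)
      (dilog (cexp (θ * I))).im := by
  have h := ((Complex.hasSum_iff _ _).mp (hasSum_dilog_exp_mul_I θ)).2
  refine h.congr_fun fun n => ?_
  have e1 : cexp (θ * I) ^ (n + 1) = cexp (((((n : ℝ) + 1) * θ : ℝ)) * I) := by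
    rw [← Complex.exp_nat_mul]
    push_cast
    ring_nf
  have e2 : ((n : ℂ) + 1) ^ 2 = ((((n : ℝ) + 1) ^ 2 : ℝ) : ℂ) := by push_cast; ring
  rw [e1, e2, Complex.div_ofReal_im, Complex.exp_ofReal_mul_I_im]

/-! ### `θ = π/3`: the residues of `n` modulo `6` -/

/-- `sin((6k + r)π/3) = sin(rπ/3)`. [folklore] -/
theorem sin_six_mul_add_mul_pi_div_three (k : ℕ) (r : ℝ) :
    Real.sin ((6 * k + r) * (π / 3)) = Real.sin (r * (π / 3)) := by
  rw [show (6 * k + r) * (π / 3) = r * (π / 3) + k * (2 * π) by ring]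
  exact Real.sin_add_nat_mul_two_pi _ _

/-- `sin(2π/3) = √3/2`. [folklore] -/
theorem sin_two_mul_pi_div_three : Real.sin (2 * (π / 3)) = √3 / 2 := by
  rw [show 2 * (π / 3) = π - π / 3 by ring, Real.sin_pi_sub, Real.sin_pi_div_three]

/-- `sin(3π/3) = 0`. [folklore] -/
theorem sin_three_mul_pi_div_three : Real.sin (3 * (π / 3)) = 0 := by
  rw [show 3 * (π / 3) = π by ring]
  exact Real.sin_pi

/-- `sin(4π/3) = −√3/2`. [folklore] -/
theorem sin_four_mul_pi_div_three : Real.sin (4 * (π / 3)) = -(√3 / 2) := by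
  rw [show 4 * (π / 3) = π / 3 + π by ring, Real.sin_add_pi, Real.sin_pi_div_three]

/-- `sin(5π/3) = −√3/2`. [folklore] -/
theorem sin_five_mul_pi_div_three : Real.sin (5 * (π / 3)) = -(√3 / 2) := by
  rw [show 5 * (π / 3) = 2 * π - π / 3 by ring, Real.sin_two_pi_sub, Real.sin_pi_div_three]

/-- `sin(6π/3) = 0`. [folklore] -/
theorem sin_six_mul_pi_div_three : Real.sin (6 * (π / 3)) = 0 := by
  rw [show 6 * (π / 3) = 2 * π by ring]
  exact Real.sin_two_pi

/-- `Σ_{k≥0} 1/(6k+2)² = ¼ Σ_{k≥0} 1/(3k+1)²`. [folklore] -/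
theorem tsum_one_div_six_mul_add_two_sq_eq :
    ∑' k : ℕ, 1 / (6 * (k : ℝ) + 2) ^ 2 = 1 / 4 * ∑' k : ℕ, 1 / (3 * (k : ℝ) + 1) ^ 2 := by
  rw [← tsum_mul_left]
  refine tsum_congr fun k => ?_
  rw [show (6 * (k : ℝ) + 2) ^ 2 = 4 * (3 * (k : ℝ) + 1) ^ 2 by ring, ← one_div_mul_one_div]

/-- `Σ_{k≥0} 1/(6k+4)² = ¼ Σ_{k≥0} 1/(3k+2)²`. [folklore] -/
theorem tsum_one_div_six_mul_add_four_sq_eq :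
    ∑' k : ℕ, 1 / (6 * (k : ℝ) + 4) ^ 2 = 1 / 4 * ∑' k : ℕ, 1 / (3 * (k : ℝ) + 2) ^ 2 := by
  rw [← tsum_mul_left]
  refine tsum_congr fun k => ?_
  rw [show (6 * (k : ℝ) + 4) ^ 2 = 4 * (3 * (k : ℝ) + 2) ^ 2 by ring, ← one_div_mul_one_div]

/-- **`Im Li₂(e^{πi/3}) = Σ_r sin(rπ/3) Σ_k 1/(6k+r)²`**: the Clausen series at `θ = π/3` summed
along the residues of `n` modulo `6` (the coefficients `sin(rπ/3)` are
`√3/2, √3/2, 0, −√3/2, −√3/2, 0`). [folklore] -/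
theorem im_dilog_exp_pi_div_three_mul_I_eq_sum :
    (dilog (cexp (↑(π / 3) * I))).im =
      √3 / 2 * (∑' k : ℕ, 1 / (6 * (k : ℝ) + 1) ^ 2) + √3 / 2 * (∑' k : ℕ, 1 / (6 * (k : ℝ) + 2) ^ 2)
        - √3 / 2 * (∑' k : ℕ, 1 / (6 * (k : ℝ) + 4) ^ 2)
        - √3 / 2 * (∑' k : ℕ, 1 / (6 * (k : ℝ) + 5) ^ 2) := by
  have hC := hasSum_sin_div_sq_im_dilog (π / 3)
  set a : ℕ → ℝ := fun n => Real.sin (((n : ℝ) + 1) * (π / 3)) / ((n : ℝ) + 1) ^ 2 with ha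
  -- reindex along `Fin 6 × ℕ ≃ ℕ`, `(j, k) ↦ 6k + j`
  let e : Fin 6 × ℕ ≃ ℕ := (Equiv.prodComm (Fin 6) ℕ).trans (Nat.divModEquiv 6).symm
  have he : ∀ p : Fin 6 × ℕ, e p = p.2 * 6 + (p.1 : ℕ) := fun p => rfl
  have htot : HasSum (fun p : Fin 6 × ℕ => a (6 * p.2 + (p.1 : ℕ)))
      (dilog (cexp (↑(π / 3) * I))).im := by
    have h := (e.hasSum_iff (f := a)).mpr hC
    refine h.congr_fun fun p => ?_
    simp only [Function.comp_apply, he]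
    congr 1
    ring
  -- the coefficients `sin((j+1)π/3)`
  let c : Fin 6 → ℝ := ![√3 / 2, √3 / 2, 0, -(√3 / 2), -(√3 / 2), 0]
  have hsin : ∀ (j : Fin 6) (k : ℕ),
      Real.sin ((((6 * k + (j : ℕ) : ℕ) : ℝ) + 1) * (π / 3)) = c j := by
    intro j k
    have e1 : (((6 * k + (j : ℕ) : ℕ) : ℝ) + 1) = 6 * (k : ℝ) + (((j : ℕ) : ℝ) + 1) := by
      push_cast
      ring
    rw [e1, sin_six_mul_add_mul_pi_div_three]
    fin_cases j
    · show Real.sin ((((0 : ℕ) : ℝ) + 1) * (π / 3)) = √3 / 2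
      rw [show (((0 : ℕ) : ℝ) + 1) * (π / 3) = π / 3 by push_cast; ring]
      exact Real.sin_pi_div_three
    · show Real.sin ((((1 : ℕ) : ℝ) + 1) * (π / 3)) = √3 / 2
      rw [show (((1 : ℕ) : ℝ) + 1) * (π / 3) = 2 * (π / 3) by push_cast; ring]
      exact sin_two_mul_pi_div_three
    · show Real.sin ((((2 : ℕ) : ℝ) + 1) * (π / 3)) = 0
      rw [show (((2 : ℕ) : ℝ) + 1) * (π / 3) = 3 * (π / 3) by push_cast; ring]
      exact sin_three_mul_pi_div_three
    · show Real.sin ((((3 : ℕ) : ℝ) + 1) * (π / 3)) = -(√3 / 2)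
      rw [show (((3 : ℕ) : ℝ) + 1) * (π / 3) = 4 * (π / 3) by push_cast; ring]
      exact sin_four_mul_pi_div_three
    · show Real.sin ((((4 : ℕ) : ℝ) + 1) * (π / 3)) = -(√3 / 2)
      rw [show (((4 : ℕ) : ℝ) + 1) * (π / 3) = 5 * (π / 3) by push_cast; ring]
      exact sin_five_mul_pi_div_three
    · show Real.sin ((((5 : ℕ) : ℝ) + 1) * (π / 3)) = 0
      rw [show (((5 : ℕ) : ℝ) + 1) * (π / 3) = 6 * (π / 3) by push_cast; ring]
      exact sin_six_mul_pi_div_three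
  -- the six fibers
  have hfib : ∀ j : Fin 6, HasSum (fun k : ℕ => a (6 * k + (j : ℕ)))
      (c j * ∑' k : ℕ, 1 / (6 * (k : ℝ) + (((j : ℕ) : ℝ) + 1)) ^ 2) := by
    intro j
    have hs : Summable (fun k : ℕ => 1 / (6 * (k : ℝ) + (((j : ℕ) : ℝ) + 1)) ^ 2) := by
      have h := summable_one_div_six_mul_add_sq ((j : ℕ) + 1)
      push_cast at h
      exact h
    have h := hs.hasSum.mul_left (c j)
    refine h.congr_fun fun k => ?_
    simp only [ha]
    rw [hsin j k]
    have e1 : (((6 * k + (j : ℕ) : ℕ) : ℝ) + 1) = 6 * (k : ℝ) + (((j : ℕ) : ℝ) + 1) := by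
      push_cast
      ring
    rw [e1]
    ring
  have h6 := htot.prod_fiberwise hfib
  have hval := h6.unique (hasSum_fintype _)
  rw [hval, Fin.sum_univ_six]
  simp only [c, Matrix.cons_val_zero, Matrix.cons_val_one, Matrix.cons_val, Fin.val_zero,
    Fin.val_one, Fin.val_two, show ((3 : Fin 6) : ℕ) = 3 from rfl,
    show ((4 : Fin 6) : ℕ) = 4 from rfl, show ((5 : Fin 6) : ℕ) = 5 from rfl]
  norm_num
  ring

/-- **CDT's remark (p. 3): `Im Li₂(e^{πi/3}) = 3√3 L(2,χ₋₃)/4`** ("`= 1.014941…` is the volume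
of the regular ideal hyperbolic tetrahedron … the volume of the non-compact hyperbolic manifold
with minimal volume [the Gieseking manifold]"), for the tree's `dilog` and `L2chi3`. Proof: the
residues `r = 1, 2, 4, 5 (mod 6)` of the Clausen series against the mod-`3`/mod-`6` series of
`ζ(2)` (`…ModSix.lean`). [cite: CalegariDimitrovTang2024, §1.1 (p. 3)] -/
theorem im_dilog_exp_pi_div_three_mul_I :
    (dilog (cexp (↑(π / 3) * I))).im = 3 * √3 / 4 * L2chi3 := by
  rw [im_dilog_exp_pi_div_three_mul_I_eq_sum, tsum_one_div_six_mul_add_two_sq_eq,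
    tsum_one_div_six_mul_add_four_sq_eq]
  have hA := tsum_one_div_three_mul_add_one_sq_eq_add
  have hB := tsum_one_div_three_mul_add_two_sq_eq_add
  have hL := L2chi3_eq_sub
  linear_combination (-(√3 / 2)) * hA + (√3 / 2) * hB - (3 * √3 / 4) * hL

/-- **The Bloch–Wigner dilogarithm at `e^{πi/3}`** — the maximal volume of an ideal hyperbolic
tetrahedron in the normalisation of `blochWignerDilog` — equals `3√3 L(2,χ₋₃)/4` (`log|e^{πi/3}| = 0`
kills the second term of `D`). [cite: CalegariDimitrovTang2024, §1.1 (p. 3)] -/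
theorem blochWignerDilog_exp_pi_div_three_mul_I :
    blochWignerDilog (cexp (↑(π / 3) * I)) = 3 * √3 / 4 * L2chi3 := by
  rw [blochWignerDilog_def, im_dilog_exp_pi_div_three_mul_I, Complex.norm_exp_ofReal_mul_I,
    Real.log_one, mul_zero, add_zero]

/-! ### `θ = 2π/3`: the residues of `n` modulo `3` -/

/-- `sin((3k + r)·2π/3) = sin(r·2π/3)`. [folklore] -/
theorem sin_three_mul_add_mul_two_pi_div_three (k : ℕ) (r : ℝ) :
    Real.sin ((3 * k + r) * (2 * π / 3)) = Real.sin (r * (2 * π / 3)) := by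
  rw [show (3 * k + r) * (2 * π / 3) = r * (2 * π / 3) + k * (2 * π) by ring]
  exact Real.sin_add_nat_mul_two_pi _ _

/-- **`Im Li₂(e^{2πi/3}) = (√3/2) L(2,χ₋₃)`**: the Clausen series at `θ = 2π/3` along `n mod 3`
(`sin(2nπ/3) = √3/2, −√3/2, 0`), i.e. `Σ χ₋₃(n)/n² = L(2,χ₋₃)` weighted by `√3/2`.
[cite: CalegariDimitrovTang2024, §1.1 (p. 3)] -/
theorem im_dilog_exp_two_pi_div_three_mul_I :
    (dilog (cexp (↑(2 * π / 3) * I))).im = √3 / 2 * L2chi3 := by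
  have hC := hasSum_sin_div_sq_im_dilog (2 * π / 3)
  set a : ℕ → ℝ := fun n => Real.sin (((n : ℝ) + 1) * (2 * π / 3)) / ((n : ℝ) + 1) ^ 2 with ha
  let e : Fin 3 × ℕ ≃ ℕ := (Equiv.prodComm (Fin 3) ℕ).trans (Nat.divModEquiv 3).symm
  have he : ∀ p : Fin 3 × ℕ, e p = p.2 * 3 + (p.1 : ℕ) := fun p => rfl
  have htot : HasSum (fun p : Fin 3 × ℕ => a (3 * p.2 + (p.1 : ℕ)))
      (dilog (cexp (↑(2 * π / 3) * I))).im := by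
    have h := (e.hasSum_iff (f := a)).mpr hC
    refine h.congr_fun fun p => ?_
    simp only [Function.comp_apply, he]
    congr 1
    ring
  let c : Fin 3 → ℝ := ![√3 / 2, -(√3 / 2), 0]
  have hsin : ∀ (j : Fin 3) (k : ℕ),
      Real.sin ((((3 * k + (j : ℕ) : ℕ) : ℝ) + 1) * (2 * π / 3)) = c j := by
    intro j k
    have e1 : (((3 * k + (j : ℕ) : ℕ) : ℝ) + 1) = 3 * (k : ℝ) + (((j : ℕ) : ℝ) + 1) := by
      push_cast
      ring
    rw [e1, sin_three_mul_add_mul_two_pi_div_three]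
    fin_cases j
    · show Real.sin ((((0 : ℕ) : ℝ) + 1) * (2 * π / 3)) = √3 / 2
      rw [show (((0 : ℕ) : ℝ) + 1) * (2 * π / 3) = 2 * (π / 3) by push_cast; ring]
      exact sin_two_mul_pi_div_three
    · show Real.sin ((((1 : ℕ) : ℝ) + 1) * (2 * π / 3)) = -(√3 / 2)
      rw [show (((1 : ℕ) : ℝ) + 1) * (2 * π / 3) = 4 * (π / 3) by push_cast; ring]
      exact sin_four_mul_pi_div_three
    · show Real.sin ((((2 : ℕ) : ℝ) + 1) * (2 * π / 3)) = 0
      rw [show (((2 : ℕ) : ℝ) + 1) * (2 * π / 3) = 6 * (π / 3) by push_cast; ring]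
      exact sin_six_mul_pi_div_three
  have hfib : ∀ j : Fin 3, HasSum (fun k : ℕ => a (3 * k + (j : ℕ)))
      (c j * ∑' k : ℕ, 1 / (3 * (k : ℝ) + (((j : ℕ) : ℝ) + 1)) ^ 2) := by
    intro j
    have hs : Summable (fun k : ℕ => 1 / (3 * (k : ℝ) + (((j : ℕ) : ℝ) + 1)) ^ 2) := by
      have h := summable_one_div_three_mul_add_sq ((j : ℕ) + 1)
      push_cast at h
      exact h
    have h := hs.hasSum.mul_left (c j)
    refine h.congr_fun fun k => ?_
    simp only [ha]
    rw [hsin j k]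
    have e1 : (((3 * k + (j : ℕ) : ℕ) : ℝ) + 1) = 3 * (k : ℝ) + (((j : ℕ) : ℝ) + 1) := by
      push_cast
      ring
    rw [e1]
    ring
  have h3 := htot.prod_fiberwise hfib
  have hval := h3.unique (hasSum_fintype _)
  rw [hval, Fin.sum_univ_three]
  simp only [c, Matrix.cons_val_zero, Matrix.cons_val_one, Matrix.cons_val, Fin.val_zero,
    Fin.val_one, Fin.val_two]
  norm_num
  rw [L2chi3_eq_sub]
  ring

/-- **CDT's middle expression**: `Im Li₂(e^{πi/3}) = (3/2) · Im Li₂(e^{2πi/3})`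
("`3√3 L(2,χ₋₃)/4 = Im(Li₂(e^{πi/3})) = (3/2)·Im(Li₂(e^{2πi/3}))`"). [cite: CalegariDimitrovTang2024, §1.1 (p. 3)] -/
theorem im_dilog_exp_pi_div_three_mul_I_eq_three_halves_mul :
    (dilog (cexp (↑(π / 3) * I))).im = 3 / 2 * (dilog (cexp (↑(2 * π / 3) * I))).im := by
  rw [im_dilog_exp_pi_div_three_mul_I, im_dilog_exp_two_pi_div_three_mul_I]
  ring

end Literature.NumberTheory.Transcendental
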